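import Summits.ResolutionOfSingularities.ResolutionOfSingularities.Theorems.EquisingularLiftEquisingularLiftNatSubchainSupplierInvDefs
import HarnessLib

/-!
# [OURS · L1 W4.5(b) · EL♮(3)] HSUB′(ReachTower₀) — THE INNER-CHAIN INVARIANT WITH THE CONE SHADOW (definitions)
# `TCPlus.MemberK`, `TCPlus.InvK` = res-L1-w45b-stub-1's `TCPlus.Member` / `TCPlus.Inv` (…NatSubchainSupplierInvDefs, p532383) + clause
# (vii) «the Member's cone `K` has special fibre EXACTLY the downstairs shadow: `K.comap jG = 𝓘⟨closure K_d⟩`»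

res-D-pv-029 g8 (HSUB′(ReachTower)₃ ASSEMBLY, res-L1-w45b-plan-1 NAMING 2026-08-27T16:17:51Z; RULING-5 16:37:19Z: the cone-form base clause
(γ-cone) and the forgetting coupling (γ-forget) ride with the tower re-cut). OURS; NOT a statement of any manuscript; AI-written, weaker than expert
review. Definitions + pure-logic projections only.

WHY A SUCCESSOR PREDICATE (my STATUS finding 2026-08-27T16:31Z / addendum 16:37Z): rung TOWER's downstairs closure `InCarrierReachK`
(…NatTowerDefs p541504) carries a fifth component, the CONE SHADOW `K_d` (`closure υ⁻¹(W ∖ {x})`, then `closure υ₁⁻¹(K_d ∖ {y})` at every inner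
step); its cone-witnessed rounds (`ConeWitness`: `Z = E ∩ closure K_d`, reduced intersection) are lifted upstairs by the Cartier cut
`V(𝓔) ∩ V(𝒦)` of the regular 3-fold `V(𝒦)`, `𝒦` = the running strict transform of the Member's cone `K` — which has the right special fibre
only if `K.comap jG = 𝓘⟨closure K_d⟩` at every inner stage. `TCPlus.Member` hides its witnesses `(X, σ, S, jG, tG, 𝓢, K)` behind `∃`, so the
clause cannot be bolted on from outside: it is conjunct (vii) of the successor predicate `TCPlus.MemberK … G T Z K_d excl` below (body of
`Member` VERBATIM ∧ (vii)); `TCPlus.InvK` is `TCPlus.Inv` with `MemberK` in both member clauses and the shadow `K_d` threaded. The four inner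
bricks of the tower driver `hsub_reachTower_of_invariant` (…NatTowerDriver) are the `…K` twins of B9 `inv_base` (res-type-100; (vii) at the base
BY CONSTRUCTION once the frame is adapted to the cone form of `W`, RULING-5 (1)), of (A)/(B) `member_strictTransform_of_regularPoint` /
`inv_step_regular` (res-L1-w45b-stub-4), of (C) `member_strictTransform_of_centredPoint` / `inv_step_singular` (res-L1-w45b-stub-1) and of B8
`tcPlus_member_centred` (res-type-100): (vii) transports through a point step by res-L1-w45b-stub-1's F⁺5 `comap_strictTransformIdeal_eq_of_model`
(…NatStrictTransformComap) for `K` ALONE — at a centred point with the package's form `Φ` (equimultiplicity `ord_{s_c} K = ord_y K̄` is the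
`CentredPackage` clause `Φ mod 𝔪_p ≠ 0`), at a regular point with a linear form (order one) — followed by res-L1-w45b-stub-4's
`strictTransformIdeal_vanishingIdeal_eq` (…NatStrictTransformVanishingIdeal p531318). `memberK_member` / `invK_inv` recover the K-free predicates.
-/

set_option linter.dupNamespace false -- mandated namespace `Summit.<Summit>.<Problem>` of this single-conjunct summit
set_option linter.overlappingInstances false -- signatures carry `[IsDomain O] [IsDiscreteValuationRing O]`

noncomputable section

open CategoryTheory CategoryTheory.Limits AlgebraicGeometry TopologicalSpace Topology IsLocalRing
open Literature.AlgebraicGeometry.Resolution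
open AlgebraicGeometry.Scheme.IdealSheafData

namespace Summit.ResolutionOfSingularities.ResolutionOfSingularities.Cruxes.EquisingularLiftNat.Sections.TCPlus

variable (O : Type) [CommRing O] [IsDomain O] [IsDiscreteValuationRing O] (k : Type) [Field k] (θ : O →+* k)
  (P : Scheme.{0}) (q : P ⟶ Spec (.of O)) (Y : Set P) (Ch : ∀ X' : Scheme.{0}, (X' ⟶ P) → Set X' → Prop)

/-- **A member of the invariant carrying the cone shadow**: `TCPlus.Member O k θ P q Y Ch G T Z excl` (clauses (i)–(vi) VERBATIM, see
…NatSubchainSupplierInvDefs) whose cone `K` has, in addition, (vii) special fibre EXACTLY the reduced closed subscheme on the downstairs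
shadow `closure K_d`: `K.comap jG = 𝓘⟨closure K_d⟩`. [OURS · L1 W4.5b] -/
def MemberK (G : Scheme.{0}) (T Z Kd : Set G) (excl : Set G) : Prop :=
  ∃ (X : Scheme.{0}) (σ : X ⟶ P) (S : Set X) (jG : G ⟶ X) (tG : G ⟶ Spec (.of k)) (𝓢 K : X.IdealSheafData),
    Ch X σ S ∧ IsIntegral X ∧ IsLocallyNoetherian X ∧ Scheme.IsRegular X ∧ IsDominant (σ ≫ q) ∧
    IsPullback jG tG (σ ≫ q) (Spec.map (CommRingCat.ofHom θ)) ∧ jG '' T = S ∧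
    -- (i) exact special fibre
    (𝓢 ⊔ K).comap jG = vanishingIdeal (⟨closure Z, isClosed_closure⟩ : Closeds G) ∧
    -- (ii) flat over `O`
    Flat ((𝓢 ⊔ K).subschemeι ≫ σ ≫ q) ∧
    -- (iii) the carrier is regular, both ideal sheaves are locally principal
    Scheme.IsRegular 𝓢.subscheme ∧ (∀ z : X, (stalkIdeal 𝓢 z).IsPrincipal ∧ (stalkIdeal K z).IsPrincipal) ∧
    -- (iv) off the generic point of `Y`
    σ '' ((𝓢 ⊔ K).support : Set X) ⊆ {y : P | ¬ IsGenericPoint y Y} ∧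
    -- (v) regular quotient stalks at the special points, off the excluded ones — of codimension `2` at the closed ones
    (∀ z ∈ ((𝓢 ⊔ K).support : Set X), (σ ≫ q) z = closedPoint O → z ∉ jG '' excl →
      IsRegularLocalRing (X.presheaf.stalk z ⧸ stalkIdeal (𝓢 ⊔ K) z) ∧
      (IsClosed ({z} : Set X) →
        ringKrullDim (X.presheaf.stalk z ⧸ stalkIdeal (𝓢 ⊔ K) z) + 2 = ringKrullDim (X.presheaf.stalk z))) ∧
    -- (vi) centred packages at the excluded points
    (∀ y₀ ∈ excl, CentredPackage O P q X σ 𝓢 K (jG y₀)) ∧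
    -- (vii) the cone's special fibre is the downstairs shadow
    K.comap jG = vanishingIdeal (⟨closure Kd, isClosed_closure⟩ : Closeds G)

/-- **The inner invariant with the cone shadow, `INV W G β T Z K_d b`** of the tower driver `hsub_reachTower_of_invariant`: `TCPlus.Inv`
with `MemberK` in both member clauses (the uncentred member and, while `b = false`, the centred member at every closed non-regular point of
`V(closure Z)_red`), the shadow `K_d` threaded. [OURS · L1 W4.5b] -/
def InvK {F₁ F₂ : Scheme.{0}} (_W : Set F₁) (G : Scheme.{0}) (_β : G ⟶ F₂) (T Z Kd : Set G) (b : Bool) : Prop :=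
  IsIntegral G ∧ IsClosed T ∧ IsIrreducible T ∧ ¬ T ⊆ closure Z ∧ MemberK O k θ P q Y Ch G T Z Kd ∅ ∧
    (b = false → ∀ y : ↥(vanishingIdeal (⟨closure Z, isClosed_closure⟩ : Closeds G)).subscheme,
      IsClosed ({((vanishingIdeal (⟨closure Z, isClosed_closure⟩ : Closeds G)).subschemeι y : G)} : Set G) →
      ¬ IsRegularLocalRing ((vanishingIdeal (⟨closure Z, isClosed_closure⟩ : Closeds G)).subscheme.presheaf.stalk y) →
      MemberK O k θ P q Y Ch G T Z Kd {((vanishingIdeal (⟨closure Z, isClosed_closure⟩ : Closeds G)).subschemeι y : G)})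

/-- A member carrying the shadow is a member. [OURS · pure logic] -/
theorem memberK_member {G : Scheme.{0}} {T Z Kd excl : Set G} (h : MemberK O k θ P q Y Ch G T Z Kd excl) :
    Member O k θ P q Y Ch G T Z excl := by
  obtain ⟨X, σ, S, jG, tG, 𝓢, K, hCh, hXint, hXnoeth, hXreg, hdom, hsq, hTS, hi, hii, hiii, hiiip, hiv, hv, hvi, -⟩ := h
  exact ⟨X, σ, S, jG, tG, 𝓢, K, hCh, hXint, hXnoeth, hXreg, hdom, hsq, hTS, hi, hii, hiii, hiiip, hiv, hv, hvi⟩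

/-- The shadow clause (vii) of a member, for the record: the cone has special fibre `𝓘⟨closure K_d⟩` for SOME realisation. [OURS · pure logic] -/
theorem memberK_shadow {G : Scheme.{0}} {T Z Kd excl : Set G} (h : MemberK O k θ P q Y Ch G T Z Kd excl) :
    ∃ (X : Scheme.{0}) (σ : X ⟶ P) (jG : G ⟶ X) (tG : G ⟶ Spec (.of k)) (K : X.IdealSheafData),
      IsPullback jG tG (σ ≫ q) (Spec.map (CommRingCat.ofHom θ)) ∧ (∀ z : X, (stalkIdeal K z).IsPrincipal) ∧
      K.comap jG = vanishingIdeal (⟨closure Kd, isClosed_closure⟩ : Closeds G) := by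
  obtain ⟨X, σ, S, jG, tG, 𝓢, K, -, -, -, -, -, hsq, -, -, -, -, hiiip, -, -, -, hvii⟩ := h
  exact ⟨X, σ, jG, tG, K, hsq, fun z => (hiiip z).2, hvii⟩

/-- The inner invariant with the shadow implies res-L1-w45b-stub-1's invariant. [OURS · pure logic] -/
theorem invK_inv {F₁ F₂ : Scheme.{0}} {W : Set F₁} {G : Scheme.{0}} {β : G ⟶ F₂} {T Z Kd : Set G} {b : Bool}
    (h : InvK O k θ P q Y Ch W G β T Z Kd b) : Inv O k θ P q Y Ch W G β T Z b := by
  obtain ⟨hG, hT, hTirr, hTZ, hmem, hcen⟩ := h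
  exact ⟨hG, hT, hTirr, hTZ, memberK_member O k θ P q Y Ch hmem,
    fun hb y hy hreg => memberK_member O k θ P q Y Ch (hcen hb y hy hreg)⟩

/-! ## Successor predicates with the Cartier clause (viii) (appended 2026-08-27T18:10Z, res-D-pv-029 g8)

The curve step of the tower (`Tower.Inv₁`'s seed, …NatTowerInvDefs) transports the cone `K` through the blow-up of the in-carrier pair
`𝒞 = 𝓢 ⊔ K` by res-D-pv-051's `coneRound` (…NatConeRoundCartier p545368, with `𝓔 := 𝓢`, `𝒦 := K`): `V(St_𝒞 K) ≅ V(K)` because the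
centre is the CARTIER divisor `𝓢|_{V(K)}` of `V(K)` — which is clause (viii) `IsEffectiveCartier (𝓢.comap K.subschemeι)` («the carrier
surface and the cone have no common component»). It holds at the base because `K = St_{τ₁} K₀` is `𝓢`-saturated by definition of the
strict transform (`isBlowup_subscheme_strictTransformIdeal` ⇒ the exceptional divisor of `V(St K₀) → V(K₀)` is `𝓢|_{V(St K₀)}`), and it
transports through the in-carrier point steps (pull back the Cartier divisor `𝓢|_{V(K)}` along the blow-up `V(St K) → V(K)` and cancel
the new exceptional factor). `MemberKC` / `InvKC` := `MemberK` / `InvK` ∧ (viii); the `…KC` twins of the inner bricks are the targets. -/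

/-- **A member carrying the cone shadow AND the Cartier clause**: `TCPlus.MemberK` (clauses (i)–(vii)) ∧ (viii) the carrier `𝓢` cuts an
EFFECTIVE CARTIER divisor on the cone `V(K)` (`IsEffectiveCartier (𝓢.comap K.subschemeι)`). [OURS · L1 W4.5b] -/
def MemberKC (G : Scheme.{0}) (T Z Kd : Set G) (excl : Set G) : Prop :=
  ∃ (X : Scheme.{0}) (σ : X ⟶ P) (S : Set X) (jG : G ⟶ X) (tG : G ⟶ Spec (.of k)) (𝓢 K : X.IdealSheafData),
    Ch X σ S ∧ IsIntegral X ∧ IsLocallyNoetherian X ∧ Scheme.IsRegular X ∧ IsDominant (σ ≫ q) ∧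
    IsPullback jG tG (σ ≫ q) (Spec.map (CommRingCat.ofHom θ)) ∧ jG '' T = S ∧
    -- (i) exact special fibre
    (𝓢 ⊔ K).comap jG = vanishingIdeal (⟨closure Z, isClosed_closure⟩ : Closeds G) ∧
    -- (ii) flat over `O`
    Flat ((𝓢 ⊔ K).subschemeι ≫ σ ≫ q) ∧
    -- (iii) the carrier is regular, both ideal sheaves are locally principal
    Scheme.IsRegular 𝓢.subscheme ∧ (∀ z : X, (stalkIdeal 𝓢 z).IsPrincipal ∧ (stalkIdeal K z).IsPrincipal) ∧
    -- (iv) off the generic point of `Y`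
    σ '' ((𝓢 ⊔ K).support : Set X) ⊆ {y : P | ¬ IsGenericPoint y Y} ∧
    -- (v) regular quotient stalks at the special points, off the excluded ones — of codimension `2` at the closed ones
    (∀ z ∈ ((𝓢 ⊔ K).support : Set X), (σ ≫ q) z = closedPoint O → z ∉ jG '' excl →
      IsRegularLocalRing (X.presheaf.stalk z ⧸ stalkIdeal (𝓢 ⊔ K) z) ∧
      (IsClosed ({z} : Set X) →
        ringKrullDim (X.presheaf.stalk z ⧸ stalkIdeal (𝓢 ⊔ K) z) + 2 = ringKrullDim (X.presheaf.stalk z))) ∧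
    -- (vi) centred packages at the excluded points
    (∀ y₀ ∈ excl, CentredPackage O P q X σ 𝓢 K (jG y₀)) ∧
    -- (vii) the cone's special fibre is the downstairs shadow
    K.comap jG = vanishingIdeal (⟨closure Kd, isClosed_closure⟩ : Closeds G) ∧
    -- (viii) the carrier cuts an effective Cartier divisor on the cone
    IsEffectiveCartier (𝓢.comap K.subschemeι)

/-- **The inner invariant with shadow and Cartier clause, `INV W G β T Z K_d b`**: `TCPlus.InvK` with `MemberKC` members. [OURS · L1 W4.5b] -/
def InvKC {F₁ F₂ : Scheme.{0}} (_W : Set F₁) (G : Scheme.{0}) (_β : G ⟶ F₂) (T Z Kd : Set G) (b : Bool) : Prop :=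
  IsIntegral G ∧ IsClosed T ∧ IsIrreducible T ∧ ¬ T ⊆ closure Z ∧ MemberKC O k θ P q Y Ch G T Z Kd ∅ ∧
    (b = false → ∀ y : ↥(vanishingIdeal (⟨closure Z, isClosed_closure⟩ : Closeds G)).subscheme,
      IsClosed ({((vanishingIdeal (⟨closure Z, isClosed_closure⟩ : Closeds G)).subschemeι y : G)} : Set G) →
      ¬ IsRegularLocalRing ((vanishingIdeal (⟨closure Z, isClosed_closure⟩ : Closeds G)).subscheme.presheaf.stalk y) →
      MemberKC O k θ P q Y Ch G T Z Kd {((vanishingIdeal (⟨closure Z, isClosed_closure⟩ : Closeds G)).subschemeι y : G)})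

/-- A member with shadow and Cartier clause is a member with shadow. [OURS · pure logic] -/
theorem memberKC_memberK {G : Scheme.{0}} {T Z Kd excl : Set G} (h : MemberKC O k θ P q Y Ch G T Z Kd excl) :
    MemberK O k θ P q Y Ch G T Z Kd excl := by
  obtain ⟨X, σ, S, jG, tG, 𝓢, K, hCh, hXint, hXnoeth, hXreg, hdom, hsq, hTS, hi, hii, hiii, hiiip, hiv, hv, hvi, hvii, -⟩ := h
  exact ⟨X, σ, S, jG, tG, 𝓢, K, hCh, hXint, hXnoeth, hXreg, hdom, hsq, hTS, hi, hii, hiii, hiiip, hiv, hv, hvi, hvii⟩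

/-- The inner invariant with shadow and Cartier clause implies the one with shadow (and hence stub-1's). [OURS · pure logic] -/
theorem invKC_invK {F₁ F₂ : Scheme.{0}} {W : Set F₁} {G : Scheme.{0}} {β : G ⟶ F₂} {T Z Kd : Set G} {b : Bool}
    (h : InvKC O k θ P q Y Ch W G β T Z Kd b) : InvK O k θ P q Y Ch W G β T Z Kd b := by
  obtain ⟨hG, hT, hTirr, hTZ, hmem, hcen⟩ := h
  exact ⟨hG, hT, hTirr, hTZ, memberKC_memberK O k θ P q Y Ch hmem,
    fun hb y hy hreg => memberKC_memberK O k θ P q Y Ch (hcen hb y hy hreg)⟩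

/-! ## Successor predicates with the LOCALIZED shadow trace (vii-loc) (appended 2026-08-27T21:10Z, res-D-pv-029 g8; res-type-100's S7
FINDING 20:46:11Z / res-D-pv-029 DECISION 20:53:20Z): the global exact trace (vii) `K·𝒪_G = 𝓘⟨closure K_d⟩` is NOT suppliable at the seed
(a cone whose special fibre is EXACTLY `St_x W` is a lift of `W`; the B-series cone's fibre is `St_x W ∪` components away from `x`), and every
use of it in the tower is local near the exceptional surfaces, all of which lie over `x`. `MemberKCL`/`InvKCL` = `MemberKC`/`InvKC` with (vii)
replaced by (vii-loc): equality of the two ideal sheaves RESTRICTED (`comap` along the open immersion `V.ι`) to an open `V ⊇ Z`. -/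

/-- **`TCPlus.MemberKCL`** — `MemberKC` with the shadow trace LOCALIZED near the carrier curve (vii-loc). [OURS · L1 W4.5b] -/
def MemberKCL (G : Scheme.{0}) (T Z Kd : Set G) (excl : Set G) : Prop :=
  ∃ (X : Scheme.{0}) (σ : X ⟶ P) (S : Set X) (jG : G ⟶ X) (tG : G ⟶ Spec (.of k)) (𝓢 K : X.IdealSheafData),
    Ch X σ S ∧ IsIntegral X ∧ IsLocallyNoetherian X ∧ Scheme.IsRegular X ∧ IsDominant (σ ≫ q) ∧
    IsPullback jG tG (σ ≫ q) (Spec.map (CommRingCat.ofHom θ)) ∧ jG '' T = S ∧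
    -- (i) exact special fibre
    (𝓢 ⊔ K).comap jG = vanishingIdeal (⟨closure Z, isClosed_closure⟩ : Closeds G) ∧
    -- (ii) flat over `O`
    Flat ((𝓢 ⊔ K).subschemeι ≫ σ ≫ q) ∧
    -- (iii) the carrier is regular, both ideal sheaves are locally principal
    Scheme.IsRegular 𝓢.subscheme ∧ (∀ z : X, (stalkIdeal 𝓢 z).IsPrincipal ∧ (stalkIdeal K z).IsPrincipal) ∧
    -- (iv) off the generic point of `Y`
    σ '' ((𝓢 ⊔ K).support : Set X) ⊆ {y : P | ¬ IsGenericPoint y Y} ∧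
    -- (v) regular quotient stalks at the special points, off the excluded ones — of codimension `2` at the closed ones
    (∀ z ∈ ((𝓢 ⊔ K).support : Set X), (σ ≫ q) z = closedPoint O → z ∉ jG '' excl →
      IsRegularLocalRing (X.presheaf.stalk z ⧸ stalkIdeal (𝓢 ⊔ K) z) ∧
      (IsClosed ({z} : Set X) →
        ringKrullDim (X.presheaf.stalk z ⧸ stalkIdeal (𝓢 ⊔ K) z) + 2 = ringKrullDim (X.presheaf.stalk z))) ∧
    -- (vi) centred packages at the excluded points
    (∀ y₀ ∈ excl, CentredPackage O P q X σ 𝓢 K (jG y₀)) ∧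
    -- (vii-loc) the cone's special fibre is the downstairs shadow NEAR THE CARRIER CURVE (on an open neighbourhood of `Z`)
    (∃ V : G.Opens, Z ⊆ (V : Set G) ∧
      (K.comap jG).comap V.ι = (vanishingIdeal (⟨closure Kd, isClosed_closure⟩ : Closeds G)).comap V.ι) ∧
    -- (viii) the carrier cuts an effective Cartier divisor on the cone
    IsEffectiveCartier (𝓢.comap K.subschemeι)

/-- **`TCPlus.InvKCL`** — `InvKC` over `MemberKCL`. [OURS · L1 W4.5b] -/
def InvKCL {F₁ F₂ : Scheme.{0}} (_W : Set F₁) (G : Scheme.{0}) (_β : G ⟶ F₂) (T Z Kd : Set G) (b : Bool) : Prop :=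
  IsIntegral G ∧ IsClosed T ∧ IsIrreducible T ∧ ¬ T ⊆ closure Z ∧ MemberKCL O k θ P q Y Ch G T Z Kd ∅ ∧
    (b = false → ∀ y : ↥(vanishingIdeal (⟨closure Z, isClosed_closure⟩ : Closeds G)).subscheme,
      IsClosed ({((vanishingIdeal (⟨closure Z, isClosed_closure⟩ : Closeds G)).subschemeι y : G)} : Set G) →
      ¬ IsRegularLocalRing ((vanishingIdeal (⟨closure Z, isClosed_closure⟩ : Closeds G)).subscheme.presheaf.stalk y) →
      MemberKCL O k θ P q Y Ch G T Z Kd {((vanishingIdeal (⟨closure Z, isClosed_closure⟩ : Closeds G)).subschemeι y : G)})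

/-- Global ⇒ local: `MemberKC ⇒ MemberKCL` (take `V := ⊤`). [OURS · pure logic] -/
theorem memberKC_memberKCL {G : Scheme.{0}} {T Z Kd excl : Set G} (h : MemberKC O k θ P q Y Ch G T Z Kd excl) :
    MemberKCL O k θ P q Y Ch G T Z Kd excl := by
  obtain ⟨X, σ, S, jG, tG, 𝓢, K, hCh, hXint, hXnoeth, hXreg, hdom, hsq, hTS, hi, hii, hiii, hiiip, hiv, hv, hvi, hvii, hviii⟩ := h
  exact ⟨X, σ, S, jG, tG, 𝓢, K, hCh, hXint, hXnoeth, hXreg, hdom, hsq, hTS, hi, hii, hiii, hiiip, hiv, hv, hvi,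
    ⟨⊤, fun _ _ => trivial, by rw [hvii]⟩, hviii⟩

/-- `MemberKCL ⇒ Member` (forget the shadow clauses). [OURS · pure logic] -/
theorem memberKCL_member {G : Scheme.{0}} {T Z Kd excl : Set G} (h : MemberKCL O k θ P q Y Ch G T Z Kd excl) :
    Member O k θ P q Y Ch G T Z excl := by
  obtain ⟨X, σ, S, jG, tG, 𝓢, K, hCh, hXint, hXnoeth, hXreg, hdom, hsq, hTS, hi, hii, hiii, hiiip, hiv, hv, hvi, -, -⟩ := h
  exact ⟨X, σ, S, jG, tG, 𝓢, K, hCh, hXint, hXnoeth, hXreg, hdom, hsq, hTS, hi, hii, hiii, hiiip, hiv, hv, hvi⟩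

/-- `InvKC ⇒ InvKCL`. [OURS · pure logic] -/
theorem invKC_invKCL {F₁ F₂ : Scheme.{0}} {W : Set F₁} {G : Scheme.{0}} {β : G ⟶ F₂} {T Z Kd : Set G} {b : Bool}
    (h : InvKC O k θ P q Y Ch W G β T Z Kd b) : InvKCL O k θ P q Y Ch W G β T Z Kd b := by
  obtain ⟨hG, hT, hTirr, hTZ, hmem, hcen⟩ := h
  exact ⟨hG, hT, hTirr, hTZ, memberKC_memberKCL O k θ P q Y Ch hmem,
    fun hb y hy hreg => memberKC_memberKCL O k θ P q Y Ch (hcen hb y hy hreg)⟩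

/-- `InvKCL ⇒ Inv` (forget the shadow). [OURS · pure logic] -/
theorem invKCL_inv {F₁ F₂ : Scheme.{0}} {W : Set F₁} {G : Scheme.{0}} {β : G ⟶ F₂} {T Z Kd : Set G} {b : Bool}
    (h : InvKCL O k θ P q Y Ch W G β T Z Kd b) : Inv O k θ P q Y Ch W G β T Z b := by
  obtain ⟨hG, hT, hTirr, hTZ, hmem, hcen⟩ := h
  exact ⟨hG, hT, hTirr, hTZ, memberKCL_member O k θ P q Y Ch hmem,
    fun hb y hy hreg => memberKCL_member O k θ P q Y Ch (hcen hb y hy hreg)⟩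

end Summit.ResolutionOfSingularities.ResolutionOfSingularities.Cruxes.EquisingularLiftNat.Sections.TCPlus

end
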